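import Summits.QuantumFields.BalabanUV.T4Continuum.Support.NE7HintOfLocalChartSU2Wide
import Summits.QuantumFields.BalabanUV.T4Continuum.Support.NE7AxialChartTorus
import HarnessLib

/-!
# NE7 — (8)∃ FROM THE PLAQUETTE-GRADIENT REGULARITY DATUM (PG), SU(2)∕U(2) on T⁴, `L = 2` (F291): THE CHART of row NE7 DISCHARGED into axial-gauge
# kinematics (F288–F290) plus ONE gauge-invariant local datum of the tangent-critical configuration — its covariant plaquette-gradient radius
# `‖Ad_{U(q,τ)}U(∂p_{κμ}(q+e_τ)) − U(∂p_{κμ}(q))‖ ≤ C_g·(r + 4(e^β − 1) + ε)∕M³` ([Balaban1985Variational] Thm 1 (9)–(10) TYPE)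

Cell `pub-balaban`, rung (B)+1 sub-cell t4, lineage `b2b-balaban-t4-ne7-p1` (CRUX PROVER NE7 #1 = OWNER of row NE7), generation 91; memo
`t4/b2b-balaban-t4-ne7-p1-g91/COVER-OBSTRUCTION.md` §2–§4.  Over F286w `NE7HintOfLocalChartSU2Wide.hint_of_localChart_SU2_wide` (the wide-cover END) and F290b
`NE7AxialChartTorus.exists_periodic_chart` (the local chart on the torus from plaquette data).

WHY.  Gen 90's END asked THE CHART ([B8] Thm 2 at `U₀ = 1` TYPE: a periodic gauge `u`, a periodic skew `At` with `M‖At‖ ≤ C₀t`, `M²‖∇At‖ ≤ C₁t`,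
`U^{u} = e^{At}` on a torus ball) for nothing.  Gen 91: (a) on the `(4ℓ+12)`-fold cover that hypothesis was global and FALSE (torons,
`NE7LocalChartCoverObstruction`); (b) on the wide cover (`Kc = 4ℓ + 64` at `d = 4`, `L = 2`, `nbRad 4 2 = 20`) it is LOCAL, and the axial gauge DELIVERS it from the
plaquette radius `r∕M²` and the covariant plaquette-gradient radius (PG): §2 `chart_of_plaqGrad_SU2` (constants `C₀(ℓ) = 16(2ℓ+32)`,
`C₁(ℓ) = (32∕3)(2ℓ+32)C_g + (1024∕3)(2ℓ+32)² + 8∕3 + 16(2ℓ+32)`, both `≤ (400C_g + 400000)(ℓ+1)²`; needs `ε ≤ 1∕(16(2ℓ+32))`).  §3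
**`hint_of_plaqGrad_SU2`**: F286w with its `hchart` binder REPLACED by (PG): for every `C_g ≥ 0` there are `ℓ ≥ 1`, `ε₀ > 0` and, for `0 < ε ≤ ε₀`, a `β₀ > 0` such
that for `0 < β ≤ β₀`, every `N ≥ 1`: route Π's two `k`-free lines ∧ (PG) on the `(4ℓ+64)`-fold cover ∧ row NE3's `hleaves` ⟹ (8)∃ (the `hint` binder of route 1's
END) over `{V | unitary, N-periodic, SmallField V δ_V}`.
WHAT REMAINS ASSERTED FOR NOTHING: (PG) — the covariant plaquette-gradient radius `≲ t∕M³` of the tangent-critical admissible configuration, i.e. the regularity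
(9)–(10) of [Balaban1985Variational] Thm 1 for the constrained minimiser (with its uniqueness clause: tangent-critical in the class ⇒ the minimal orbit), NOT proved
in the tree; row NE3's `hleaves` ([B11] Prop 2 TYPE); route Π's two numeric lines.  A general small-field configuration has NO such chart (the obstruction is
McMullen's: `div Y = f` has no Lipschitz solution for general bounded `f`), so (PG) is where criticality enters — it is the honest interface of row NE7.
HONEST FRAMING (page 1): composition BY NAME + closed-form arithmetic; nothing of Bałaban's asserted as an axiom; NE7 NOT PROVED unconditionally; spine 0∕9; finite T⁴
rung (B)+1 — NOT infinite volume, NOT mass gap, NOT `BetaPertH`, NOT Clay.  Continuum YM on T⁴ ⇐ BetaPertH ∧ nine spine estimates (0/9 proved); BetaPertH ⇐ (D1) ∧ (D4)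
∧ CAP+tail; G-an2-4 gates asym, D1 and NE2/3/4.  No `sorry`; axioms ⊆ {propext, Classical.choice, Quot.sound}.
-/

set_option autoImplicit false

open scoped BigOperators Matrix Matrix.Norms.L2Operator Topology
open NormedSpace Finset Set Filter

namespace Summit.QuantumFields.BalabanUV.T4Continuum.NE7HintOfPlaqGradSU2

open Literature.MathematicalPhysics.QuantumFieldTheory.Balaban1983to89
open B7Prop1Explicit B7Prop2Explicit MatrixLog UnitaryModel
open B4TorusKernel.MultiPeriod (torusSupNorm)
open T4AveragingDeficitWall (Ad IsUnitaryCfg IsSkewDir SmallField vary curl curlSq dirSq dirL1)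
open T4AveragingDeficitWallBoundary (IsPeriodicCfg periodBox)
open AveragingDeficitPeriodicCounting (IsPeriodicDir)
open AveragingDeficitMultiLevelPrep (LevelSmall tower TangentIter)
open BlockAverageVaryHolo (nbRad)
open MinimalActionLevels (perWin)
open MinimalActionSandwich (IsMinimiser admissible)
open MinimalActionRate (sfClass)
open NE3HessForm (dAction)
open NE3SlicePoincareBudgetLine (CPLine)
open NE3TangentCovariantTower (dirIter)
open NE3DecomposedRepOfLinearNormalPart (ResidualSliceRepT)
open NE3QbarIterCovLiftPrep (cruxC)
open NE3SmoothRightInverseW (rightInvW)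
open NE3RightInverseSolveLetters (thetaLoc)
open NE3RightInverseL2Letter (l2C)
open NE3HatInvCurlLetters (curl2C curl1C)
open NE3EnergyShapes (IsUnitarySite)
open BlockAveragePushDirSplit (flat)
open NE7HintOfLocalChartSU2Wide (hint_of_localChart_SU2_wide)
open NE7AxialChartTorus (exists_periodic_chart)

noncomputable section

variable {n : Type*} [Fintype n] [DecidableEq n]

/-! ## §1 Closed-form arithmetic of the chart constants -/

/-- The sup letter: `M·(4(dd+1)(R_r + 1)·r∕M²) ≤ 16(L′ + 1)·T` for `dd + 1 = 4`, `R_r + 1 ≤ (L′+1)M`, `M ≥ 1`, `0 ≤ r ≤ T`. [folklore] -/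
theorem sup_const_bound {M L' r T dd Rr : ℝ} (hdd : dd + 1 = 4) (hM : 1 ≤ M) (hL' : 0 ≤ L') (hRr0 : 0 ≤ Rr) (hRr : Rr + 1 ≤ (L' + 1) * M)
    (hr0 : 0 ≤ r) (hrT : r ≤ T) :
    M * (4 * (dd + 1) * (Rr + 1) * (r / M ^ 2)) ≤ 16 * (L' + 1) * T := by
  have hM0 : 0 < M := by linarith
  rw [hdd]
  have h1 : M * (4 * (4 : ℝ) * (Rr + 1) * (r / M ^ 2)) = 16 * ((Rr + 1) / M) * r := by
    field_simp
    try ring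
  have h2 : (Rr + 1) / M ≤ L' + 1 := by
    rw [div_le_iff₀ hM0]; linarith
  have h20 : 0 ≤ (Rr + 1) / M := by positivity
  rw [h1]
  have h3 : 16 * ((Rr + 1) / M) * r ≤ 16 * (L' + 1) * r := by nlinarith
  nlinarith

/-- The gradient letter: `M²·a₁ ≤ C₁(L′, C_g)·T` with
`a₁ = (4∕3)(2(dd+1)(R_r+2)·x₁ + 16(dd+1)²(R_r+2)²·x² + 2x) + 4(dd+1)(R_r+1)x∕M`, `x = r∕M²`, `x₁ = C_g T∕M³`, for `dd + 1 = 4`, `R_r + 2 ≤ (L′+1)M`, `M ≥ 2`,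
`0 ≤ r ≤ T`, `r ≤ 1`. [folklore] -/
theorem grad_const_bound {M L' r T Cg dd Rr : ℝ} (hdd : dd + 1 = 4) (hM : 2 ≤ M) (hL' : 0 ≤ L') (hCg : 0 ≤ Cg) (hRr0 : 0 ≤ Rr)
    (hRr : Rr + 2 ≤ (L' + 1) * M) (hr0 : 0 ≤ r) (hrT : r ≤ T) (hr1 : r ≤ 1) :
    M ^ 2 * (4 / 3 * (2 * (dd + 1) * (Rr + 2) * (Cg * T / M ^ 3) + 16 * (dd + 1) ^ 2 * (Rr + 2) ^ 2 * (r / M ^ 2) ^ 2 + 2 * (r / M ^ 2))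
        + 4 * (dd + 1) * (Rr + 1) * (r / M ^ 2) / M)
      ≤ (32 / 3 * (L' + 1) * Cg + 1024 / 3 * (L' + 1) ^ 2 + 8 / 3 + 16 * (L' + 1)) * T := by
  have hM0 : 0 < M := by linarith
  have hT0 : 0 ≤ T := hr0.trans hrT
  rw [hdd]
  have hq1 : (Rr + 2) / M ≤ L' + 1 := by rw [div_le_iff₀ hM0]; linarith
  have hq2 : (Rr + 1) / M ≤ L' + 1 := by rw [div_le_iff₀ hM0]; linarith
  have hq10 : 0 ≤ (Rr + 2) / M := by positivity
  have hq20 : 0 ≤ (Rr + 1) / M := by positivity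
  have hsplit : M ^ 2 * (4 / 3 * (2 * (4 : ℝ) * (Rr + 2) * (Cg * T / M ^ 3) + 16 * (4 : ℝ) ^ 2 * (Rr + 2) ^ 2 * (r / M ^ 2) ^ 2 + 2 * (r / M ^ 2))
        + 4 * (4 : ℝ) * (Rr + 1) * (r / M ^ 2) / M)
      = 32 / 3 * ((Rr + 2) / M) * (Cg * T) + 1024 / 3 * ((Rr + 2) / M) ^ 2 * r ^ 2 + 8 / 3 * r + 16 * ((Rr + 1) / M) * r := by
    field_simp
    try ring
  rw [hsplit]
  have t1 : 32 / 3 * ((Rr + 2) / M) * (Cg * T) ≤ 32 / 3 * (L' + 1) * Cg * T := by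
    have := mul_le_mul_of_nonneg_right hq1 (mul_nonneg hCg hT0)
    nlinarith
  have t2 : 1024 / 3 * ((Rr + 2) / M) ^ 2 * r ^ 2 ≤ 1024 / 3 * (L' + 1) ^ 2 * T := by
    have hsq : ((Rr + 2) / M) ^ 2 ≤ (L' + 1) ^ 2 := pow_le_pow_left₀ hq10 hq1 2
    have hr2 : r ^ 2 ≤ T := by nlinarith
    have := mul_le_mul hsq hr2 (sq_nonneg r) (by positivity)
    nlinarith
  have t3 : 8 / 3 * r ≤ 8 / 3 * T := by linarith
  have t4 : 16 * ((Rr + 1) / M) * r ≤ 16 * (L' + 1) * T := by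
    have := mul_le_mul hq2 hrT hr0 (by positivity)
    nlinarith
  nlinarith

/-! ## §2 THE CHART from the plaquette-gradient datum (PG) -/

set_option maxHeartbeats 800000 in
/-- **THE CHART OF ROW NE7 FROM (PG), SU(2)∕U(2) on T⁴, `L = 2`.**  For `ℓ`, `N ≥ 1`, a cover factor `Kc ≥ 4ℓ + 64`, `0 ≤ ε ≤ 1∕(16(2ℓ+32))`, `β ≥ 0`,
`C_g ≥ 0`: IF every tangent-critical admissible `U` of the class (period `N·Kc·2^{k+1}`) with `SmallField U (r∕M²)`, `0 ≤ r ≤ ε∕4`, has covariant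
plaquette gradients `≤ C_g(r + 4(e^β−1) + ε)∕M³` in every direction (PG), THEN the `hchart` binder of F286w holds with `C₀ = 16(2ℓ+32)` and
`C₁ = (32∕3)(2ℓ+32)C_g + (1024∕3)(2ℓ+32)² + 8∕3 + 16(2ℓ+32)` (the axial gauge about `z` on the cube of radius `(2ℓ+31)M`, cut off over a collar `M`, periodised:
F290b `NE7AxialChartTorus.exists_periodic_chart`). [folklore] -/
theorem chart_of_plaqGrad_SU2 [Nonempty n] (ℓ : ℕ) {N : ℕ} [NeZero N] (hN : 1 ≤ N) {Kc : ℕ} (hKc : 4 * ℓ + 64 ≤ Kc) {ε β Cg : ℝ} (hε0 : 0 ≤ ε)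
    (hεℓ : ε ≤ 1 / (16 * (2 * (ℓ : ℝ) + 32))) (hβ0 : 0 ≤ β) (hCg : 0 ≤ Cg)
    (hPG : (∀ D : Site 4 → Fin 4 → (Matrix n n ℂ)ˣ, IsUnitaryCfg D → IsPeriodicCfg D ((N * Kc) : ℤ) → SmallField D (4 * (Real.exp β - 1)) →
      ∀ (k : ℕ), ∀ U ∈ admissible (sfClass 4 2 (N * Kc) ε) 2 (k + 1) D,
      (∀ φ : Site 4 → Fin 4 → Matrix n n ℂ, IsSkewDir φ → IsPeriodicDir φ (((N * Kc) * 2 ^ (k + 1) : ℕ) : ℤ) → TangentIter 2 k U φ →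
        dAction U φ (perWin 4 ((N * Kc) * 2 ^ (k + 1))) = 0) →
      ∀ r : ℝ, 0 ≤ r → r ≤ (1 / ((2 : ℕ) : ℝ) ^ 2 * ε) → SmallField U (r / (((2 : ℕ) : ℝ) ^ (k + 1)) ^ 2) →
      ∀ (q : Site 4) (τ μ κ : Fin 4), κ ≠ μ →
        ‖Ad (U q τ) ((hol U (q + e τ) (plaqWord κ μ) : (Matrix n n ℂ)ˣ) : Matrix n n ℂ) - ((hol U q (plaqWord κ μ) : (Matrix n n ℂ)ˣ) : Matrix n n ℂ)‖
          ≤ Cg * (r + 4 * (Real.exp β - 1) + ε) / (((2 : ℕ) : ℝ) ^ (k + 1)) ^ 3)) :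
    (∀ D : Site 4 → Fin 4 → (Matrix n n ℂ)ˣ, IsUnitaryCfg D → IsPeriodicCfg D ((N * Kc) : ℤ) → SmallField D (4 * (Real.exp β - 1)) →
      ∀ (k : ℕ), ∀ U ∈ admissible (sfClass 4 2 (N * Kc) ε) 2 (k + 1) D,
      (∀ φ : Site 4 → Fin 4 → Matrix n n ℂ, IsSkewDir φ → IsPeriodicDir φ (((N * Kc) * 2 ^ (k + 1) : ℕ) : ℤ) → TangentIter 2 k U φ →
        dAction U φ (perWin 4 ((N * Kc) * 2 ^ (k + 1))) = 0) →
      ∀ r : ℝ, 0 ≤ r → r ≤ (1 / ((2 : ℕ) : ℝ) ^ 2 * ε) → SmallField U (r / (((2 : ℕ) : ℝ) ^ (k + 1)) ^ 2) →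
      ∀ z : Site 4, ∃ (u : Site 4 → (Matrix n n ℂ)ˣ) (At : Site 4 → Fin 4 → Matrix n n ℂ) (a₀ a₁ : ℝ),
        IsUnitarySite u ∧ (∀ (y : Site 4) (i : Fin 4), u (y + (((N * Kc) * 2 ^ (k + 1) : ℕ) : ℤ) • e i) = u y) ∧
        IsSkewDir At ∧ IsPeriodicDir At (((N * Kc) * 2 ^ (k + 1) : ℕ) : ℤ) ∧ 0 ≤ a₀ ∧ 0 ≤ a₁ ∧
        (∀ (y : Site 4) (κ : Fin 4), ‖At y κ‖ ≤ a₀) ∧ (∀ (y : Site 4) (κ τ : Fin 4), ‖At (y + e τ) κ - At y κ‖ ≤ a₁) ∧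
        ((2 : ℕ) : ℝ) ^ (k + 1) * a₀ ≤ (16 * (2 * (ℓ : ℝ) + 32)) * (r + 4 * (Real.exp β - 1) + ε) ∧ (((2 : ℕ) : ℝ) ^ (k + 1)) ^ 2 * a₁ ≤ (32 / 3 * (2 * (ℓ : ℝ) + 32) * Cg + 1024 / 3 * (2 * (ℓ : ℝ) + 32) ^ 2 + 8 / 3 + 16 * (2 * (ℓ : ℝ) + 32)) * (r + 4 * (Real.exp β - 1) + ε) ∧
        (∀ (y : Site 4) (κ : Fin 4),
          torusSupNorm (fun _ : Fin 4 => 2 ^ (k + 1) * (N * Kc)) (y - z) ≤ (((nbRad 4 2 + 2 * ℓ + 10) * 2 ^ (k + 1) : ℕ) : ℝ) →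
            gaugeAct u U y κ = vary (flat (d := 4) (n := n)) At 1 y κ)) := by
  intro D hDu hDP hDs k U hU hcrit r hr0 hr hUr z
  -- the block size `M = 2^{k+1}` (generalised), the radii, the period `N·Kc·M`
  have hM2 : 2 ≤ 2 ^ (k + 1) :=
    calc 2 = 2 ^ 1 := by norm_num
      _ ≤ 2 ^ (k + 1) := Nat.pow_le_pow_right (by norm_num) (by omega)
  have hMr' : ((2 : ℕ) : ℝ) ^ (k + 1) = ((2 ^ (k + 1) : ℕ) : ℝ) := by rw [Nat.cast_pow]
  -- (PG) read as the all-directions gradient hypothesis (before generalising the block size)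
  have hgrad : ∀ (q : Site 4) (τ μ κ : Fin 4), κ ≠ μ →
      ‖Ad (U q τ) ((hol U (q + e τ) (plaqWord κ μ) : (Matrix n n ℂ)ˣ) : Matrix n n ℂ) - ((hol U q (plaqWord κ μ) : (Matrix n n ℂ)ˣ) : Matrix n n ℂ)‖
        ≤ Cg * (r + 4 * (Real.exp β - 1) + ε) / (((2 : ℕ) : ℝ) ^ (k + 1)) ^ 3 :=
    fun q τ μ κ hκ => hPG D hDu hDP hDs k U hU hcrit r hr0 hr hUr q τ μ κ hκ
  clear hPG
  rw [hMr'] at hUr hgrad ⊢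
  generalize hMdef : 2 ^ (k + 1) = M at *
  have hM1 : 1 ≤ M := by omega
  have hMr : (2 : ℝ) ≤ (M : ℝ) := by exact_mod_cast hM2
  have hM0r : (0 : ℝ) < (M : ℝ) := by linarith
  have hℓ0 : (0 : ℝ) ≤ (ℓ : ℝ) := Nat.cast_nonneg ℓ
  -- the class data of `U`
  have hUu : IsUnitaryCfg U := hU.1.1
  have hUP : IsPeriodicCfg U ((N * Kc * M : ℕ) : ℤ) := by rw [← hMdef]; exact hU.1.2.1
  -- the datum `t`
  have hβ' : 0 ≤ 4 * (Real.exp β - 1) := by nlinarith [Real.add_one_le_exp β]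
  have hrT : r ≤ r + 4 * (Real.exp β - 1) + ε := by linarith
  have hT0 : 0 ≤ r + 4 * (Real.exp β - 1) + ε := hr0.trans hrT
  have hε1 : ε ≤ 1 := hεℓ.trans (by rw [div_le_one (by positivity)]; nlinarith)
  have hr4 : r ≤ ε / 4 := by
    have e := hr
    norm_num at e
    linarith
  have hr1 : r ≤ 1 := by linarith
  have hx0 : 0 ≤ r / (M : ℝ) ^ 2 := by positivity
  have hx10 : 0 ≤ Cg * (r + 4 * (Real.exp β - 1) + ε) / (M : ℝ) ^ 3 := by positivity
  -- the geometric conditions of F290b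
  have hMwR : M ≤ (2 * ℓ + 31) * M := by nlinarith
  have hPR : 2 * ((2 * ℓ + 31) * M) + 4 ≤ N * Kc * M := by
    have h1 : 4 * ℓ + 64 ≤ N * Kc := hKc.trans (Nat.le_mul_of_pos_left _ (by omega))
    have h2 : (4 * ℓ + 64) * M ≤ N * Kc * M := Nat.mul_le_mul_right _ h1
    nlinarith
  have hs : 2 * (((3 : ℕ) : ℝ) + 1) * ((((2 * ℓ + 31) * M : ℕ) : ℝ) + 1) * (r / (M : ℝ) ^ 2) ≤ 1 / 4 := by
    have h1 : ((((2 * ℓ + 31) * M : ℕ) : ℝ) + 1) ≤ (2 * (ℓ : ℝ) + 32) * M := by push_cast; nlinarith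
    have h2 : 2 * (((3 : ℕ) : ℝ) + 1) * ((((2 * ℓ + 31) * M : ℕ) : ℝ) + 1) * (r / (M : ℝ) ^ 2)
        ≤ 8 * ((2 * (ℓ : ℝ) + 32) * M) * (r / (M : ℝ) ^ 2) := by
      rw [show (((3 : ℕ) : ℝ) + 1) = 4 by norm_num]
      nlinarith
    have h4 : 8 * ((2 * (ℓ : ℝ) + 32) * M) * (r / (M : ℝ) ^ 2) = 8 * (2 * (ℓ : ℝ) + 32) * (r / M) := by field_simp; try ring
    have h5 : r / (M : ℝ) ≤ r := by rw [div_le_iff₀ hM0r]; nlinarith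
    have h6 : 8 * (2 * (ℓ : ℝ) + 32) * (ε / 4) ≤ 1 / 8 := by
      have h7 := hεℓ
      rw [le_div_iff₀ (by positivity)] at h7
      nlinarith
    have h8 : 0 ≤ 8 * (2 * (ℓ : ℝ) + 32) := by positivity
    have h9 := mul_le_mul_of_nonneg_left (h5.trans hr4) h8
    linarith
  -- F290b
  obtain ⟨u, At, huU, huP, hAs, hAP, hsup, hgr, hagree⟩ :=
    exists_periodic_chart (d := 3) (n := n) hUu hUP hx0 hx10 hUr hgrad z ((2 * ℓ + 31) * M) M hM1 hMwR hPR hs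
  refine ⟨u, At, _, _, huU, huP, hAs, hAP, ?_, ?_, hsup, hgr, ?_, ?_, ?_⟩
  · positivity
  · positivity
  · -- `M·a₀ ≤ C₀·t`
    have e1 : ((((2 * ℓ + 31) * M : ℕ) : ℝ)) = (2 * (ℓ : ℝ) + 31) * M := by push_cast; ring
    rw [e1]
    have h := sup_const_bound (M := (M : ℝ)) (L' := 2 * (ℓ : ℝ) + 31) (T := r + 4 * (Real.exp β - 1) + ε) (dd := ((3 : ℕ) : ℝ)) (Rr := (2 * (ℓ : ℝ) + 31) * M)
      (by norm_num) (by linarith) (by positivity) (by positivity) (by nlinarith) hr0 hrT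
    refine h.trans (le_of_eq ?_)
    ring
  · -- `M²·a₁ ≤ C₁·t`
    have e1 : ((((2 * ℓ + 31) * M : ℕ) : ℝ)) = (2 * (ℓ : ℝ) + 31) * M := by push_cast; ring
    rw [e1]
    have h := grad_const_bound (M := (M : ℝ)) (L' := 2 * (ℓ : ℝ) + 31) (T := r + 4 * (Real.exp β - 1) + ε) (Cg := Cg) (dd := ((3 : ℕ) : ℝ))
      (Rr := (2 * (ℓ : ℝ) + 31) * M) (by norm_num) hMr (by positivity) hCg (by positivity) (by nlinarith) hr0 hrT hr1
    refine h.trans (le_of_eq ?_)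
    ring
  · -- agreement on the ball of radius `(nbRad 4 2 + 2ℓ + 10)·M = (2ℓ+30)·M`
    intro y κ hy
    apply hagree y κ
    have e2 : (2 * ℓ + 31) * M - M = (nbRad 4 2 + 2 * ℓ + 10) * M := by
      apply Nat.sub_eq_of_eq_add
      unfold BlockAverageVaryHolo.nbRad
      ring
    rw [e2]
    convert hy using 2
    funext i
    ring

/-! ## §3 (8)∃ from (PG): THE CHART discharged -/

set_option maxHeartbeats 800000 in
/-- **F291 — (8)∃ FROM THE PLAQUETTE-GRADIENT DATUM (PG), SU(2)∕U(2) on T⁴, `L = 2`.**  [Balaban1985Variational] Thm 1 (8) ∘ Prop 8 ∘ (9)–(10) TYPE, rows NE7 ∘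
NE3, `card n = 2`: for every `C_g ≥ 0` there are `ℓ ≥ 1`, `ε₀ > 0` and, for every `0 < ε ≤ ε₀`, a `β₀ > 0` such that for `0 < β ≤ β₀` and every period `N ≥ 1`: IF
route Π's two `k`-free lines (letters `C₂, αh, Ch, νh, κh`), the PLAQUETTE-GRADIENT DATUM (PG) with constant `C_g` for the tangent-critical admissible configurations
on the `(4ℓ+64)`-fold cover (small field `r ≤ ε∕4`), and row NE3's `hleaves` (at `δ₁ = ε∕8`) hold, THEN for some `δ_V > 0`, over `{V | unitary, N-periodic,
SmallField V δ_V}`, at every level some constrained minimiser over `sfClass 4 2 N ε` is `SmallField U a` with `0 ≤ a < ε∕(2^k)²`.  THE CHART is no longer a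
hypothesis (§2 over F288–F290); NE7 is NOT proved unconditionally ((PG), `hleaves` and the two lines remain). -/
theorem hint_of_plaqGrad_SU2 [Nonempty n] (hn : Fintype.card n = 2) {Cg : ℝ} (hCg : 0 ≤ Cg) :
    ∃ ℓ : ℕ, 1 ≤ ℓ ∧ ∃ ε₀ : ℝ, 0 < ε₀ ∧ ∀ ε : ℝ, 0 < ε → ε ≤ ε₀ → ∃ β₀ : ℝ, 0 < β₀ ∧ ∀ β : ℝ, 0 < β → β ≤ β₀ →
    ∀ (N : ℕ) [NeZero N] (C₂ αh Ch νh κh : ℝ), 1 ≤ N →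
    0 ≤ C₂ → 0 ≤ αh → αh ≤ 1 → 0 ≤ Ch →
    νh = 2 * Real.sqrt (l2C 4 2 / (1 - thetaLoc 4 2 * ε) ^ 2 + curl2C 4 2 / (1 - thetaLoc 4 2 * ε) ^ 2) * C₂ * Ch * αh →
    κh = 4 * (curl1C 4 2 / (1 - thetaLoc 4 2 * ε)) * C₂ * Ch ^ 2 * ε →
    νh < 1 →
    2 * (κh / (1 - νh) ^ 2) < ((((1 / 2 - (νh / (1 - νh)) ^ 2) / (2 * (1 + (CPLine 4 2 2 (1 / 10 ^ 17) (1 / 10 ^ 53) + 1))) - (νh / (1 - νh)) ^ 2) / 2 - 576 * ((4 : ℕ) : ℝ) * (αh ^ 2 * Real.exp (2 * αh))) / (Fintype.card n : ℝ) - 28 * ((4 : ℕ) : ℝ) * (ε + 7 * αh ^ 2)) →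
    -- (PG): the covariant plaquette-gradient radius of the tangent-critical admissible configurations on the `(4ℓ+64)`-fold cover
    (∀ D : Site 4 → Fin 4 → (Matrix n n ℂ)ˣ, IsUnitaryCfg D → IsPeriodicCfg D ((N * (4 * ℓ + 64)) : ℤ) → SmallField D (4 * (Real.exp β - 1)) →
      ∀ (k : ℕ), ∀ U ∈ admissible (sfClass 4 2 (N * (4 * ℓ + 64)) ε) 2 (k + 1) D,
      (∀ φ : Site 4 → Fin 4 → Matrix n n ℂ, IsSkewDir φ → IsPeriodicDir φ (((N * (4 * ℓ + 64)) * 2 ^ (k + 1) : ℕ) : ℤ) → TangentIter 2 k U φ →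
        dAction U φ (perWin 4 ((N * (4 * ℓ + 64)) * 2 ^ (k + 1))) = 0) →
      ∀ r : ℝ, 0 ≤ r → r ≤ (1 / ((2 : ℕ) : ℝ) ^ 2 * ε) → SmallField U (r / (((2 : ℕ) : ℝ) ^ (k + 1)) ^ 2) →
      ∀ (q : Site 4) (τ μ κ : Fin 4), κ ≠ μ →
        ‖Ad (U q τ) ((hol U (q + e τ) (plaqWord κ μ) : (Matrix n n ℂ)ˣ) : Matrix n n ℂ) - ((hol U q (plaqWord κ μ) : (Matrix n n ℂ)ˣ) : Matrix n n ℂ)‖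
          ≤ Cg * (r + 4 * (Real.exp β - 1) + ε) / (((2 : ℕ) : ℝ) ^ (k + 1)) ^ 3) →
    -- ROW NE3's PER-PAIR BINDER on the data class (F31's `hleaves`)
    (∀ D : Site 4 → Fin 4 → (Matrix n n ℂ)ˣ, IsUnitaryCfg D → IsPeriodicCfg D (N : ℤ) → SmallField D (4 * (Real.exp β - 1)) → ∀ (k : ℕ), ∀ Us ∈ admissible (sfClass 4 2 N ε) 2 (k + 1) D, SmallField Us ((1 / ((2 : ℕ) : ℝ) ^ 2 * ε / 2) / (((2 : ℕ) : ℝ) ^ (k + 1)) ^ 2) → (∀ φ : Site 4 → Fin 4 → Matrix n n ℂ, IsSkewDir φ → IsPeriodicDir φ ((N * 2 ^ (k + 1) : ℕ) : ℤ) → TangentIter 2 k Us φ → dAction Us φ (perWin 4 (N * 2 ^ (k + 1))) = 0) → ∀ U' ∈ admissible (sfClass 4 2 N ε) 2 (k + 1) D, ∃ (u : Site 4 → (Matrix n n ℂ)ˣ) (X₀ : Site 4 → Fin 4 → Matrix n n ℂ) (α₀ : ℝ) (m : Site 4 → Fin 4 → ℝ) (C : ℝ), IsSkewDir X₀ ∧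 (∀ (hWu : IsUnitaryCfg Us) (hx : 0 ≤ ε / (((2 : ℕ) : ℝ) ^ (k + 1)) ^ 2) (hs : LevelSmall 4 2 k (ε / (((2 : ℕ) : ℝ) ^ (k + 1)) ^ 2)) (hWx : SmallField Us (ε / (((2 : ℕ) : ℝ) ^ (k + 1)) ^ 2)) (hθ : cruxC 4 2 * ((((2 : ℕ) : ℝ) ^ (k + 1)) ^ 2 * (ε / (((2 : ℕ) : ℝ) ^ (k + 1)) ^ 2)) < 1) (hφ : IsSkewDir (dirIter 2 (k + 1) Us X₀)), ResidualSliceRepT 2 N (k + 1) Us U' u X₀ (rightInvW (by norm_num) k hWu hx hs hWx N hθ hφ) α₀) ∧ (∀ z κ, 0 ≤ m z κ) ∧ 0 ≤ C ∧ (((2 : ℕ) : ℝ) ^ (k + 1)) ^ 4 * ∑ z ∈ periodBox (d := 4) N, ∑ κ : Fin 4, m z κ ^ 2 ≤ C ^ 2 * dirSq X₀ (periodBox (d := 4) (N * 2 ^ (k + 1))) ∧ (∀ z ∈ periodBox (d := 4) N, ∀ κ : Fin 4, ‖dirIter 2 (k + 1) Us X₀ z κ‖ ≤ C₂ * (((2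 : ℕ) : ℝ) ^ (k + 1) * m z κ) ^ 2) ∧ α₀ * ((2 : ℕ) : ℝ) ^ (k + 1) ≤ αh ∧ (∀ z κ, m z κ * ((2 : ℕ) : ℝ) ^ (k + 1) ≤ αh) ∧ C ≤ Ch) →
    ∃ δV : ℝ, 0 < δV ∧
      ∀ V ∈ {V : Site 4 → Fin 4 → (Matrix n n ℂ)ˣ | IsUnitaryCfg V ∧ IsPeriodicCfg V (N : ℤ) ∧ SmallField V δV},
      ∀ k : ℕ, ∃ U : Site 4 → Fin 4 → (Matrix n n ℂ)ˣ, IsMinimiser 4 (sfClass 4 2 N ε) 2 N k V U ∧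
        ∃ a : ℝ, 0 ≤ a ∧ a < ε / (((2 : ℕ) : ℝ) ^ k) ^ 2 ∧ SmallField U a := by
  obtain ⟨ℓ, hℓ1, ε₀, hε₀, H⟩ := hint_of_localChart_SU2_wide (n := n) hn (A := 400 * Cg + 400000) (by positivity) 2
  have hεc : (0 : ℝ) < 1 / (16 * (2 * (ℓ : ℝ) + 32)) := by positivity
  refine ⟨ℓ, hℓ1, min ε₀ (1 / (16 * (2 * (ℓ : ℝ) + 32))), lt_min hε₀ hεc, fun ε hε hεle => ?_⟩
  obtain ⟨β₀, hβ₀, H2⟩ := H ε hε (hεle.trans (min_le_left _ _))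
  refine ⟨β₀, hβ₀, ?_⟩
  intro β hβ hβle N _ C₂ αh Ch νh κh hN hC₂ hαh0 hαh1 hCh0 hνh hκh hν hline hPG hleaves
  -- the chart constants are polynomial: `C₀(ℓ), C₁(ℓ) ≤ (400 C_g + 400000)(ℓ+1)²`
  have hℓr : (1 : ℝ) ≤ (ℓ : ℝ) := by exact_mod_cast hℓ1
  have hC₀ : (0 : ℝ) ≤ 16 * (2 * (ℓ : ℝ) + 32) := by positivity
  have hsq1 : (1 : ℝ) ≤ ((ℓ : ℝ) + 1) ^ 2 := by nlinarith
  have hsq2 : (ℓ : ℝ) + 1 ≤ ((ℓ : ℝ) + 1) ^ 2 := by nlinarith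
  have hC₀b : 16 * (2 * (ℓ : ℝ) + 32) ≤ (400 * Cg + 400000) * ((ℓ : ℝ) + 1) ^ 2 := by
    have h1 : 16 * (2 * (ℓ : ℝ) + 32) ≤ 512 * ((ℓ : ℝ) + 1) ^ 2 := by nlinarith
    nlinarith [mul_nonneg hCg (sq_nonneg ((ℓ : ℝ) + 1))]
  have hC₁ : (0 : ℝ) ≤ 32 / 3 * (2 * (ℓ : ℝ) + 32) * Cg + 1024 / 3 * (2 * (ℓ : ℝ) + 32) ^ 2 + 8 / 3 + 16 * (2 * (ℓ : ℝ) + 32) := by positivity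
  have hC₁b : 32 / 3 * (2 * (ℓ : ℝ) + 32) * Cg + 1024 / 3 * (2 * (ℓ : ℝ) + 32) ^ 2 + 8 / 3 + 16 * (2 * (ℓ : ℝ) + 32)
      ≤ (400 * Cg + 400000) * ((ℓ : ℝ) + 1) ^ 2 := by
    have h1 : 2 * (ℓ : ℝ) + 32 ≤ 32 * ((ℓ : ℝ) + 1) ^ 2 := by nlinarith
    have h2 : (2 * (ℓ : ℝ) + 32) ^ 2 ≤ 1024 * ((ℓ : ℝ) + 1) ^ 2 := by nlinarith
    have p1 : 32 / 3 * (2 * (ℓ : ℝ) + 32) * Cg ≤ 400 * Cg * ((ℓ : ℝ) + 1) ^ 2 := by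
      have := mul_le_mul_of_nonneg_right h1 hCg
      nlinarith [mul_nonneg hCg (sq_nonneg ((ℓ : ℝ) + 1))]
    have p2 : 1024 / 3 * (2 * (ℓ : ℝ) + 32) ^ 2 ≤ 349526 * ((ℓ : ℝ) + 1) ^ 2 := by nlinarith
    have p3 : (8 : ℝ) / 3 ≤ 3 * ((ℓ : ℝ) + 1) ^ 2 := by nlinarith
    have p4 : 16 * (2 * (ℓ : ℝ) + 32) ≤ 512 * ((ℓ : ℝ) + 1) ^ 2 := by nlinarith
    nlinarith [mul_nonneg hCg (sq_nonneg ((ℓ : ℝ) + 1))]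
  have hchart := chart_of_plaqGrad_SU2 (n := n) ℓ hN (Kc := 4 * ℓ + 64) le_rfl hε.le (hεle.trans (min_le_right _ _)) hβ.le hCg hPG
  exact H2 β hβ hβle N (4 * ℓ + 64) (16 * (2 * (ℓ : ℝ) + 32))
    (32 / 3 * (2 * (ℓ : ℝ) + 32) * Cg + 1024 / 3 * (2 * (ℓ : ℝ) + 32) ^ 2 + 8 / 3 + 16 * (2 * (ℓ : ℝ) + 32)) C₂ αh Ch νh κh hN (by omega)
    hC₂ hαh0 hαh1 hCh0 hνh hκh hν hline hC₀ hC₀b hC₁ hC₁b hchart hleaves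

end

end Summit.QuantumFields.BalabanUV.T4Continuum.NE7HintOfPlaqGradSU2
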